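import Summits.PneNP.PneNP.Theses.RootDecompMcspDial
import Summits.PneNP.PneNP.Theorems.SoloBlindAnchor
import Literature.Barriers.PneNP.MCSPHardnessObstructionsPadding
import Literature.Computability.Complexity.NPClosureProofs
import Literature.Computability.Complexity.StringCopy
import Literature.Computability.Complexity.BranchingFn

/-!
# `RootDecompMcspDial.McspExpHard` (stmt-PneNP-27847) — the decided upper end of the MCSP succinct-hardness dial

Node N11 of the decomp-pnenp root-decomposition cell (route `route-PneNP-RootDecompMcspDial`, lens-3 g4
«McspSuccinctDial»): at the notch `𝒟 = EXP` the A-side statement of the dial is a THEOREM — if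
`P = NP` then MCSP is NP-hard for sparse NP languages under polynomial-time reductions whose padded bit
and witness-verifier languages lie in `EXP`.  Under `NP ⊆ P` the indicator reduction `x ↦ y₁ / []`
(`y₁` a fixed yes-instance of MCSP, `[]` a no-instance) is polynomial-time (`iteFn` over the `FP`
indicator of `L ∈ NP ⊆ P`), its padded composite `f ∘ lpad 1` is in `FE`, and preimages of the `P`
languages `BitLang`, `Ver` under an `FE` map are in `EXP` (`preimage_mem_EXP`).  Port of the lens kernel
`algorithmicaHardness_EXP` / `hardVia_EXP_of_NP_subset_P` (HOME/decomp-pnenp-lens-3/McspSuccinctDial.lean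
sha256 1ee0b32c…); census tribunal batch 1 (TRIB-PNENP-ROOTDECOMP-1) and the cell's cycle-2 order list
the item as provable-now.  0 sorry.
[cite: MurrayWilliams2017, §4; AroraBarak2009]
-/

namespace Summit.PneNP.PneNP.Theorems

open _root_.Computability Literature.Computability.Complexity
  Literature.Computability.Complexity.Nondeterministic Literature.Computability.MetaComplexity
  Literature.Computability.MetaComplexity.MCSPVerif
  Literature.Barriers.PneNP Literature.Barriers.PneNP.KarpAssembly
open scoped Literature.Computability.Complexity.Notation

/-- A yes-instance of `MCSP` exists. [folklore] -/
private theorem mcspExp_exists_mem_MCSP : ∃ y : List Bool, y ∈ MCSP :=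
  ⟨_, 0, fun _ => false, _, rfl, le_rfl⟩

/-- `[]` is a no-instance of `MCSP` (not a `boolPair` code). [folklore] -/
private theorem mcspExp_nil_not_mem_MCSP : ([] : List Bool) ∉ MCSP := by
  rintro ⟨n, F, s, h, -⟩
  have := congrArg List.length h
  simp only [List.length_nil, length_boolPair] at this
  omega

/-- Under `NP ⊆ P`, MCSP is NP-hard for sparse NP under poly-time reductions with `EXP`-succinct padded
bit / verifier languages: the indicator reduction (port of the lens lemma `hardVia_EXP_of_NP_subset_P`). -/
private theorem mcspExp_hardVia_EXP_of_NP_subset_P (hC : NP ⊆ Classes.P) :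
    ∀ L ∈ NP, IsSparseLanguage L → ∃ f : List Bool → List Bool, f ∈ FP ∧
      (∀ x, x ∈ L ↔ f x ∈ MCSP) ∧ (mapFstFn (f ∘ lpad 1) ⁻¹' BitLang : Language Bool) ∈ EXP ∧
      (mapFstFn (f ∘ lpad 1) ⁻¹' Ver : Language Bool) ∈ EXP := by
  intro L hL _
  obtain ⟨y₁, hy₁⟩ := mcspExp_exists_mem_MCSP
  let c : List Bool → List Bool := fun x => encodeBool (L.boolIndicator x)
  have hc : c ∈ FP := indicatorFn_mem_FP (hC hL)
  let f : List Bool → List Bool := iteFn c (fun _ => y₁) (fun _ => [])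
  have hf : f ∈ FP := iteFn_mem_FP hc (const_mem_FP _) (const_mem_FP _)
  have hg : f ∘ lpad 1 ∈ FE := comp_mem_FE hf (lpad_mem_FE 1)
  refine ⟨f, hf, fun x => ?_, ?_, ?_⟩
  · by_cases hx : x ∈ L
    · have hcx : c x = [true] := by
        show encodeBool (L.boolIndicator x) = [true]
        rw [← (Set.mem_iff_boolIndicator L x).1 hx]
        rfl
      have : f x = y₁ := iteFn_apply_true hcx
      rw [this]
      exact ⟨fun _ => hy₁, fun _ => hx⟩
    · have hcx : c x = [false] := by
        show encodeBool (L.boolIndicator x) = [false]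
        rw [← (Set.notMem_iff_boolIndicator L x).1 hx]
        rfl
      have : f x = [] := iteFn_apply_false hcx
      rw [this]
      exact ⟨fun h => absurd h hx, fun h => absurd h mcspExp_nil_not_mem_MCSP⟩
  · exact preimage_mem_EXP (mapFstFn_mem_FE hg) BitLang_mem_P
  · exact preimage_mem_EXP (mapFstFn_mem_FE hg) Ver_mem_P

/-- `¬ PneNP → NP ⊆ P`, through the tree's Cook–Clay anchor `SoloBlind.pneNP_iff_P_ne_NP`. -/
private theorem mcspExp_NP_subset_P_of_not_pneNP (hS : ¬ PneNP) : NP ⊆ Classes.P := by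
  have h : Classes.P = NP := by
    by_contra hne
    exact hS (SoloBlind.pneNP_iff_P_ne_NP.2 hne)
  exact h.symm.subset

/-- The decided upper end of the MCSP succinct-hardness dial (stmt-PneNP-27847, `McspExpHard`): if
`P = NP` then MCSP is NP-hard for sparse NP languages under polynomial-time reductions with
`EXP`-succinct padded bit / verifier languages (the indicator reduction).  Port of the lens-3 g4 kernel
`algorithmicaHardness_EXP` (decomp-pnenp cell, 2026-08-30). -/
theorem mcspExpHard_proof :
    Summit.PneNP.PneNP.Theses.RootDecompMcspDial.McspExpHard := by
  unfold Summit.PneNP.PneNP.Theses.RootDecompMcspDial.McspExpHard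
  intro hS
  exact mcspExp_hardVia_EXP_of_NP_subset_P (mcspExp_NP_subset_P_of_not_pneNP hS)

end Summit.PneNP.PneNP.Theorems
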